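import Mathlib
import Summits.PneNP.PneNP.Theorems.ConvexRankGatesCaptureSignedGadget

/-!
# Route ConvexRankGates, crux `Capture` (stmt-PneNP-2659): the matching gadget is COMPLETE — an unbalanced selection
yields a perfect matching (unbalanced-cycle door, file 4/5)

Support theorems for the crux `Summit.PneNP.PneNP.Theses.ConvexRankGates.Capture` (lead c10); objects from
`ConvexRankGatesCaptureSignedDefs.lean`, soundness from `…SignedGadget.lean`.

* `exists_isPerfectMatching_of_unbalanced` — COMPLETENESS: if `(a,0) ~ (a,1)` in the signed double cover then the
  gadget has a perfect matching: thread a simple cover path `(a,0) = z₀, …, z_L = (a,1)` through replica `a`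
  (`g — in(z₀)`, `out(z_j) — in(z_{j+1})`, `out(z_L) — g'`) and close every other vertex by its skip edge.
* `exists_isPerfectMatching_iff_unbalanced` (registered anchor) — the gadget is EXACT: it has a perfect matching
  iff the selection is unbalanced. Hence the door is a polynomial monotone projection of PERFECT MATCHING (each wire
  controlling an edge SET), the hypothesis shape of the tree's `isGRankGate_of_tutteGate`.

No new definitions. [folklore]
-/

namespace Summit.PneNP.PneNP.Theorems.Capture.Signed

set_option linter.dupNamespace false -- `Summit.PneNP.PneNP.…`: summit = sub-problem (D-0017)

open SimpleGraph Finset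

variable {V : Type} {n : ℕ} {p q : Fin n → V} {o : Fin n → Bool}

/-- **Completeness of the gadget**: if `(a,0) ~ (a,1)` in the cover then `gadget p q o v` has a perfect matching —
thread a simple cover path `(a,0) = z₀, …, z_L = (a,1)` through replica `a` (`g — in(z₀)`, `out(z_j) — in(z_{j+1})`,
`out(z_L) — g'`) and close every other vertex by its skip edge. [folklore] -/
theorem exists_isPerfectMatching_of_unbalanced [DecidableEq V] {v : Fin n → Bool} (h : Unbalanced p q o v) :
    ∃ M : (gadget p q o v).Subgraph, M.IsPerfectMatching := by
  classical
  obtain ⟨a, ⟨ω⟩⟩ := h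
  obtain ⟨π, hπ⟩ : ∃ π : (cover p q o v).Walk (a, false) (a, true), π.IsPath := ⟨ω.bypass, ω.bypass_isPath⟩
  have hinj : ∀ {j j' : ℕ}, j ≤ π.length → j' ≤ π.length → π.getVert j = π.getVert j' → j = j' :=
    fun hj hj' hjj => hπ.getVert_injOn (by simpa using hj) (by simpa using hj') hjj
  have hL0 : 0 < π.length := by
    by_contra h0
    have h00 : π.length = 0 := by omega
    exact absurd (Walk.eq_of_length_eq_zero h00) (by simp)
  have hg0 : π.getVert 0 = (a, false) := Walk.getVert_zero π
  have hgL : π.getVert π.length = (a, true) := Walk.getVert_length π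
  have hsuppL : (a, true) ∈ π.support := π.end_mem_support
  have hsupp0 : (a, false) ∈ π.support := π.start_mem_support
  -- the directed partner relation
  let S : GV V → GV V → Prop := fun x y =>
    (x = Sum.inr false ∧ y = Sum.inl (a, (a, false), false)) ∨
    (x = Sum.inl (a, (a, true), true) ∧ y = Sum.inr true) ∨
    (∃ j, j < π.length ∧ x = Sum.inl (a, π.getVert j, true) ∧ y = Sum.inl (a, π.getVert (j + 1), false)) ∨
    (∃ w z, x = Sum.inl (w, z, false) ∧ y = Sum.inl (w, z, true) ∧ (w ≠ a ∨ z ∉ π.support))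
  have hS : ∀ x y, S x y → (gadget p q o v).Adj x y := by
    rintro x y (⟨rfl, rfl⟩ | ⟨rfl, rfl⟩ | ⟨j, hj, rfl, rfl⟩ | ⟨w, z, rfl, rfl, -⟩)
    · exact adj_src_iff.2 ⟨a, rfl⟩
    · exact (adj_snk_iff.2 ⟨a, rfl⟩).symm
    · have hadj := π.adj_getVert_succ hj
      rw [cover_adj_iff_drel] at hadj
      obtain ⟨-, i, hi, hd⟩ := hadj
      rw [gadget_adj]
      exact ⟨by simp, Or.inl (Or.inr ⟨i, hi, a, _, _, rfl, rfl, hd⟩)⟩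
    · rw [gadget_adj]
      exact ⟨by simp, Or.inl (Or.inl (Or.inl ⟨w, z, rfl, rfl⟩))⟩
  let M : (gadget p q o v).Subgraph :=
    { verts := Set.univ
      Adj := fun x y => S x y ∨ S y x
      adj_sub := fun {x y} hxy => hxy.elim (hS x y) fun h' => (hS y x h').symm
      edge_vert := fun _ => Set.mem_univ _
      symm := ⟨fun _ _ hxy => hxy.symm⟩ }
  refine ⟨M, Subgraph.isPerfectMatching_iff.2 fun x => ?_⟩
  show ∃! y, S x y ∨ S y x
  rcases x with ⟨w, z, b⟩ | c
  · by_cases hw : a = w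
    · subst hw
      by_cases hz : z ∈ π.support
      · obtain ⟨j, rfl, hjL⟩ := Walk.mem_support_iff_exists_getVert.1 hz
        cases b
        · -- in-vertex on the path
          by_cases hj0 : j = 0
          · subst hj0
            refine ⟨Sum.inr false, Or.inr (Or.inl ⟨rfl, by rw [hg0]⟩), ?_⟩
            rintro y (hy | hy)
            · rcases hy with ⟨h1, -⟩ | ⟨h1, -⟩ | ⟨j', -, h1, -⟩ | ⟨w', z', h1, rfl, hc⟩
              · simp at h1
              · simp at h1
              · simp at h1
              · simp only [Sum.inl.injEq, Prod.mk.injEq, and_true] at h1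
                obtain ⟨rfl, rfl⟩ := h1
                exact (hc.elim (fun h => h rfl) (fun h => h hz)).elim
            · rcases hy with ⟨rfl, -⟩ | ⟨-, h2⟩ | ⟨j', hj', rfl, h2⟩ | ⟨w', z', rfl, h2, -⟩
              · rfl
              · simp at h2
              · simp only [Sum.inl.injEq, Prod.mk.injEq, true_and, and_true] at h2
                exact absurd (hinj (by omega) (by omega) h2) (by omega)
              · simp at h2
          · have hj1 : j - 1 < π.length := by omega
            have hj1' : j - 1 + 1 = j := Nat.sub_add_cancel (Nat.pos_of_ne_zero hj0)
            refine ⟨Sum.inl (a, π.getVert (j - 1), true),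
              Or.inr (Or.inr (Or.inr (Or.inl ⟨j - 1, hj1, rfl, by rw [hj1']⟩))), ?_⟩
            rintro y (hy | hy)
            · rcases hy with ⟨h1, -⟩ | ⟨h1, -⟩ | ⟨j', -, h1, -⟩ | ⟨w', z', h1, rfl, hc⟩
              · simp at h1
              · simp at h1
              · simp at h1
              · simp only [Sum.inl.injEq, Prod.mk.injEq, and_true] at h1
                obtain ⟨rfl, rfl⟩ := h1
                exact (hc.elim (fun h => h rfl) (fun h => h hz)).elim
            · rcases hy with ⟨rfl, h2⟩ | ⟨-, h2⟩ | ⟨j', hj', rfl, h2⟩ | ⟨w', z', rfl, h2, -⟩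
              · simp only [Sum.inl.injEq, Prod.mk.injEq, true_and, and_true] at h2
                exact absurd (hinj (by omega) (by omega) (h2.trans hg0.symm)) hj0
              · simp at h2
              · simp only [Sum.inl.injEq, Prod.mk.injEq, true_and, and_true] at h2
                have hjj := hinj hjL (by omega) h2
                subst hjj
                simp
              · simp at h2
        · -- out-vertex on the path
          by_cases hjL' : j = π.length
          · subst hjL'
            refine ⟨Sum.inr true, Or.inl (Or.inr (Or.inl ⟨by rw [hgL], rfl⟩)), ?_⟩
            rintro y (hy | hy)
            · rcases hy with ⟨h1, -⟩ | ⟨-, rfl⟩ | ⟨j', hj', h1, rfl⟩ | ⟨w', z', h1, -, -⟩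
              · simp at h1
              · rfl
              · simp only [Sum.inl.injEq, Prod.mk.injEq, true_and, and_true] at h1
                exact absurd (hinj le_rfl (by omega) h1) (by omega)
              · simp at h1
            · rcases hy with ⟨-, h2⟩ | ⟨-, h2⟩ | ⟨j', -, -, h2⟩ | ⟨w', z', rfl, h2, hc⟩
              · simp at h2
              · simp at h2
              · simp at h2
              · simp only [Sum.inl.injEq, Prod.mk.injEq, and_true] at h2
                obtain ⟨rfl, rfl⟩ := h2
                exact (hc.elim (fun h => h rfl) (fun h => h hz)).elim
          · have hjlt : j < π.length := lt_of_le_of_ne hjL hjL'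
            refine ⟨Sum.inl (a, π.getVert (j + 1), false),
              Or.inl (Or.inr (Or.inr (Or.inl ⟨j, hjlt, rfl, rfl⟩))), ?_⟩
            rintro y (hy | hy)
            · rcases hy with ⟨h1, -⟩ | ⟨h1, rfl⟩ | ⟨j', hj', h1, rfl⟩ | ⟨w', z', h1, -, -⟩
              · simp at h1
              · simp only [Sum.inl.injEq, Prod.mk.injEq, true_and, and_true] at h1
                exact absurd (hinj hjL le_rfl (h1.trans hgL.symm)) hjL'
              · simp only [Sum.inl.injEq, Prod.mk.injEq, true_and, and_true] at h1
                have hjj := hinj hjL (by omega) h1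
                subst hjj
                rfl
              · simp at h1
            · rcases hy with ⟨-, h2⟩ | ⟨-, h2⟩ | ⟨j', -, -, h2⟩ | ⟨w', z', rfl, h2, hc⟩
              · simp at h2
              · simp at h2
              · simp at h2
              · simp only [Sum.inl.injEq, Prod.mk.injEq, and_true] at h2
                obtain ⟨rfl, rfl⟩ := h2
                exact (hc.elim (fun h => h rfl) (fun h => h hz)).elim
      · -- replica `a`, off the path: skip edge
        refine ⟨Sum.inl (a, z, !b), ?_, ?_⟩
        · cases b
          · exact Or.inl (Or.inr (Or.inr (Or.inr ⟨a, z, rfl, rfl, Or.inr hz⟩)))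
          · exact Or.inr (Or.inr (Or.inr (Or.inr ⟨a, z, rfl, rfl, Or.inr hz⟩)))
        · rintro y (hy | hy)
          · rcases hy with ⟨h1, -⟩ | ⟨h1, rfl⟩ | ⟨j', -, h1, rfl⟩ | ⟨w', z', h1, rfl, -⟩
            · simp at h1
            · simp only [Sum.inl.injEq, Prod.mk.injEq, true_and] at h1
              exact absurd (h1.1 ▸ hsuppL) hz
            · simp only [Sum.inl.injEq, Prod.mk.injEq, true_and] at h1
              exact absurd (h1.1 ▸ π.getVert_mem_support j') hz
            · simp only [Sum.inl.injEq, Prod.mk.injEq] at h1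
              obtain ⟨rfl, rfl, rfl⟩ := h1
              rfl
          · rcases hy with ⟨rfl, h2⟩ | ⟨-, h2⟩ | ⟨j', -, rfl, h2⟩ | ⟨w', z', rfl, h2, -⟩
            · simp only [Sum.inl.injEq, Prod.mk.injEq, true_and] at h2
              exact absurd (h2.1 ▸ hsupp0) hz
            · simp at h2
            · simp only [Sum.inl.injEq, Prod.mk.injEq, true_and] at h2
              exact absurd (h2.1 ▸ π.getVert_mem_support (j' + 1)) hz
            · simp only [Sum.inl.injEq, Prod.mk.injEq] at h2
              obtain ⟨rfl, rfl, rfl⟩ := h2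
              rfl
    · -- another replica: skip edge
      refine ⟨Sum.inl (w, z, !b), ?_, ?_⟩
      · have hw' : w ≠ a := fun h => hw h.symm
        cases b
        · exact Or.inl (Or.inr (Or.inr (Or.inr ⟨w, z, rfl, rfl, Or.inl hw'⟩)))
        · exact Or.inr (Or.inr (Or.inr (Or.inr ⟨w, z, rfl, rfl, Or.inl hw'⟩)))
      · rintro y (hy | hy)
        · rcases hy with ⟨h1, -⟩ | ⟨h1, -⟩ | ⟨j', -, h1, -⟩ | ⟨w', z', h1, rfl, -⟩
          · simp at h1
          · simp only [Sum.inl.injEq, Prod.mk.injEq] at h1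
            exact absurd h1.1.symm hw
          · simp only [Sum.inl.injEq, Prod.mk.injEq] at h1
            exact absurd h1.1.symm hw
          · simp only [Sum.inl.injEq, Prod.mk.injEq] at h1
            obtain ⟨rfl, rfl, rfl⟩ := h1
            rfl
        · rcases hy with ⟨-, h2⟩ | ⟨-, h2⟩ | ⟨j', -, -, h2⟩ | ⟨w', z', rfl, h2, -⟩
          · simp only [Sum.inl.injEq, Prod.mk.injEq] at h2
            exact absurd h2.1.symm hw
          · simp at h2
          · simp only [Sum.inl.injEq, Prod.mk.injEq] at h2
            exact absurd h2.1.symm hw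
          · simp only [Sum.inl.injEq, Prod.mk.injEq] at h2
            obtain ⟨rfl, rfl, rfl⟩ := h2
            rfl
  · -- the two absorbers
    cases c
    · refine ⟨Sum.inl (a, (a, false), false), Or.inl (Or.inl ⟨rfl, rfl⟩), ?_⟩
      rintro y (hy | hy)
      · rcases hy with ⟨-, rfl⟩ | ⟨h1, -⟩ | ⟨j', -, h1, -⟩ | ⟨w', z', h1, -, -⟩
        · rfl
        · simp at h1
        · simp at h1
        · simp at h1
      · rcases hy with ⟨-, h2⟩ | ⟨-, h2⟩ | ⟨j', -, -, h2⟩ | ⟨w', z', -, h2, -⟩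
        · simp at h2
        · simp at h2
        · simp at h2
        · simp at h2
    · refine ⟨Sum.inl (a, (a, true), true), Or.inr (Or.inr (Or.inl ⟨rfl, rfl⟩)), ?_⟩
      rintro y (hy | hy)
      · rcases hy with ⟨h1, -⟩ | ⟨h1, -⟩ | ⟨j', -, h1, -⟩ | ⟨w', z', h1, -, -⟩
        · simp at h1
        · simp at h1
        · simp at h1
        · simp at h1
      · rcases hy with ⟨-, h2⟩ | ⟨rfl, -⟩ | ⟨j', -, -, h2⟩ | ⟨w', z', -, h2, -⟩
        · simp at h2
        · rfl
        · simp at h2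
        · simp at h2


/-- **The gadget is exact** (registered anchor): `gadget p q o v` has a perfect matching iff the selection is
unbalanced. [folklore] -/
theorem exists_isPerfectMatching_iff_unbalanced : ∀ {V : Type} [Fintype V] [DecidableEq V] {n : ℕ}
    {p q : Fin n → V} {o : Fin n → Bool} {v : Fin n → Bool},
    (∃ M : (gadget p q o v).Subgraph, M.IsPerfectMatching) ↔ Unbalanced p q o v := by
  intro V _ _ n p q o v
  exact ⟨fun ⟨_, hM⟩ => unbalanced_of_isPerfectMatching hM, exists_isPerfectMatching_of_unbalanced⟩

end Summit.PneNP.PneNP.Theorems.Capture.Signed
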